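import Literature.Analysis.FluidPDE.StokesTorusPositivityProofs
import HarnessLib

/-!
# The Stokes operator on the flat torus is self-adjoint (discharge)

Sibling proof file of `Literature.Analysis.FluidPDE.StokesTorus` (D-0014), next to
`StokesTorusProofs` (eigenfields, Galerkin spaces), `StokesTorusPositivityProofs` (the graph on
the Fourier side, symmetry, positivity) and `StokesTorusCompletenessProofs` (Galerkin
convergence): the named fact `Torus.isSelfAdjoint_stokesOperatorH : Prop` is discharged here as
`Torus.isSelfAdjoint_stokesOperatorH_holds`.

Recall the set-up of `StokesTorus`: `H = Torus.energySpace d` is the `L²(T^d; ℝ^d)` closure of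
the span of the smooth solenoidal mean-zero fields `𝒱`, and the Stokes operator *in the Hilbert
space `H`*, `Torus.stokesOperatorH d : H →ₗ.[ℝ] H`, is Mathlib's `Submodule.toLinearPMap` of the
weak graph `{(v, w) ∈ H × H | ⟪w, g⟫ = -⟪v, Δ g⟫ for all g ∈ 𝒱}` (`Torus.IsStokesImage`).

## The source

P. Constantin, C. Foias, *Navier–Stokes Equations* (Univ. Chicago Press, 1988), Ch. 4:
Definition 4.1 (`A = -PΔ`, `D(A) = H² ∩ V`), Proposition 4.2 (`A` is symmetric) and
**Theorem 4.3 (`A` is selfadjoint)**; in the space-periodic case `Ω = T^n` the book describes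
`H`, `D(A)` and `A` on the Fourier side, (4.33)–(4.37):
`H = {u | ū_k = u_{-k}, u₀ = 0, ⟨u_k, k⟩ = 0}`, `D(A) = H_{2,L} ∩ H`,
`(A u)_k = (4π²/L²) |k|² u_k`, with eigenfunctions `c w_k + c̄ w_{-k}`, `c ⊥ k` (4.42).

## The proof formalised here (`L = 1`)

The argument runs through the **Fourier description of the weak graph**: for `v, w ∈ H`,

  `IsStokesImage v w ↔ ∀ k, ŵ(k) = 4π²|k|² v̂(k)`,   `v̂ = 𝓕(complexify ∘ v)`,

which is (4.37). The direction (→) is `Torus.IsStokesImage.mFourierCoeff_eq` of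
`StokesTorusPositivityProofs`; the direction (←), `Torus.isStokesImage_of_mFourierCoeff_eq`
below, is Parseval for real vector fields (`Torus.hasSum_re_inner_mFourierCoeff_inner`) together
with `𝓕(Δ g)(k) = -4π²|k|² ĝ(k)` (`Torus.mFourierCoeff_complexify_laplacian`).

From this: `A` is symmetric (Prop. 4.2, `Torus.IsStokesImage.inner_symm`); the transversal real
single modes `Re (e_k • z)`, `k ≠ 0`, `k · z = 0` (the eigenfields of (4.42)) lie in `D(A)`
with `A G = 4π²|k|² G`, and they are complete in `H` (an element of `H` orthogonal to all of them
has all Fourier coefficients zero: a transversal coefficient of an element of `H` that pairs to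
zero with every transversal vector vanishes,
`Torus.mFourierCoeff_eq_zero_of_mem_energySpace_of_forall_re_inner`), so `D(A)` is dense in `H`
and `A ≤ A†` (`LinearPMap.IsFormalAdjoint.le_adjoint`); finally, for `y ∈ D(A†)` the adjoint
identity tested on the modes gives `(A† y)^(k) = 4π²|k|² ŷ(k)`, whence `(y, A† y)` lies in the
graph by (←), i.e. `D(A†) ≤ D(A)` and `A† = A` (`LinearPMap.eq_of_le_of_domain_eq`). This is
Theorem 4.3 in the periodic case, proved exactly as the self-adjointness of a real diagonal
operator on its maximal domain (cf. `HilbertBasis.isSelfAdjoint_diagonalPMap_holds`).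

## References

* P. Constantin, C. Foias, *Navier–Stokes Equations*, Chicago Lectures in Mathematics, Univ.
  Chicago Press (1988), Ch. 4, Def. 4.1, Prop. 4.2, Thm. 4.3, (4.33)–(4.37), (4.42).
  [ConstantinFoias1988]
* L. Grafakos, *Classical Fourier Analysis*, 3rd ed. (2014), Prop. 3.2.7 (3) (Parseval).
  [Grafakos2014]
-/

noncomputable section

open MeasureTheory Filter UnitAddTorus
open scoped InnerProductSpace RealInnerProductSpace ENNReal
open Literature.Analysis.FunctionSpaces.EuclideanSpace (complexify)
open Literature.Analysis.FunctionSpaces.Torus (energySpace realTrigPoly memLp_realTrigPoly)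

namespace Literature.Analysis.FluidPDE

namespace Torus

variable {d : Type*} [Fintype d] [DecidableEq d]

/-! ## Fourier coefficients of `L²` classes: scalar multiples, vanishing of transversal modes -/

omit [DecidableEq d] in
/-- Fourier coefficients of a real multiple of an `L²` class:
`𝓕(complexify ∘ (c • v))(k) = c • 𝓕(complexify ∘ v)(k)` (the coercion of `c • v` is a.e.
`c • v`, `Lp.coeFn_smul`; `complexify` is real linear). [folklore] -/
theorem mFourierCoeff_complexify_coe_smul (c : ℝ)
    (v : Lp (EuclideanSpace ℝ d) 2 (volume : Measure (UnitAddTorus d))) (k : d → ℤ) :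
    mFourierCoeff (complexify ∘
        ((c • v : Lp (EuclideanSpace ℝ d) 2 (volume : Measure (UnitAddTorus d))) :
          UnitAddTorus d → EuclideanSpace ℝ d)) k =
      (c : ℂ) • mFourierCoeff (complexify ∘ (v : UnitAddTorus d → EuclideanSpace ℝ d)) k := by
  have hae : complexify ∘
      ((c • v : Lp (EuclideanSpace ℝ d) 2 (volume : Measure (UnitAddTorus d))) :
        UnitAddTorus d → EuclideanSpace ℝ d) =ᵐ[volume]
      complexify ∘ (c • (v : UnitAddTorus d → EuclideanSpace ℝ d)) :=
    (Lp.coeFn_smul c v).fun_comp complexify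
  have hfun : complexify ∘ (c • (v : UnitAddTorus d → EuclideanSpace ℝ d)) =
      (c : ℂ) • (complexify ∘ (v : UnitAddTorus d → EuclideanSpace ℝ d)) := by
    funext x
    simp only [Function.comp_apply, Pi.smul_apply, LinearIsometry.map_smul]
    rw [Complex.coe_smul]
  rw [FunctionSpaces.Torus.mFourierCoeff_congr_ae hae k, hfun,
    FunctionSpaces.Torus.mFourierCoeff_const_smul]

/-- **A transversal Fourier mode of an element of `H` that pairs trivially with all transversal
vectors vanishes.** If `u ∈ H` and `Re ⟪û(k), z⟫_ℂ = 0` for every `z ∈ ℂ^d` with `k · z = 0`,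
then `û(k) = 0` (for `k = 0` every `z` is transversal): the coefficient `û(k)` is itself
transversal (`u ∈ H` is weakly divergence free, `Torus.isWeaklyDivFree_of_mem_energySpace` and
`Torus.IsWeaklyDivFree.sum_mul_mFourierCoeff_eq_zero`; Constantin–Foias 1988, (4.33)), the
hypothesis for `z` and `i z` kills `⟪û(k), z⟫_ℂ`, and one takes `z = û(k)`.
[cite: ConstantinFoias1988, Ch. 4 (4.33)] -/
theorem mFourierCoeff_eq_zero_of_mem_energySpace_of_forall_re_inner
    {u : Lp (EuclideanSpace ℝ d) 2 (volume : Measure (UnitAddTorus d))} (hu : u ∈ energySpace d)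
    {k : d → ℤ} (h : ∀ z : EuclideanSpace ℂ d, ∑ j, (k j : ℂ) * z j = 0 →
      (inner ℂ (mFourierCoeff (complexify ∘ (u : UnitAddTorus d → EuclideanSpace ℝ d)) k)
        z).re = 0) :
    mFourierCoeff (complexify ∘ (u : UnitAddTorus d → EuclideanSpace ℝ d)) k = 0 := by
  set c := mFourierCoeff (complexify ∘ (u : UnitAddTorus d → EuclideanSpace ℝ d)) k with hc
  -- `û(k)` is transversal
  have hct : ∑ j, (k j : ℂ) * c j = 0 :=
    (isWeaklyDivFree_of_mem_energySpace hu).sum_mul_mFourierCoeff_eq_zero (Lp.memLp u) k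
  -- `⟪û(k), z⟫ = 0` for every transversal `z` (real part from `z`, imaginary part from `i z`)
  have hinner : ∀ z : EuclideanSpace ℂ d, ∑ j, (k j : ℂ) * z j = 0 → inner ℂ c z = 0 := by
    intro z hz
    have hIz : ∑ j, (k j : ℂ) * (Complex.I • z) j = 0 := by
      have h' : ∑ j, (k j : ℂ) * (Complex.I • z) j = Complex.I * ∑ j, (k j : ℂ) * z j := by
        rw [Finset.mul_sum]
        refine Finset.sum_congr rfl fun j _ => ?_
        rw [PiLp.smul_apply, smul_eq_mul]
        ring
      rw [h', hz, mul_zero]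
    have h1 := h z hz
    have h2 := h _ hIz
    rw [inner_smul_right, Complex.mul_re, Complex.I_re, Complex.I_im, zero_mul, one_mul,
      zero_sub, neg_eq_zero] at h2
    apply Complex.ext
    · simpa using h1
    · simpa using h2
  exact inner_self_eq_zero.mp (hinner c hct)

/-! ## The weak Stokes graph on the Fourier side, converse direction -/

/-- **The weak Stokes relation on the Fourier side, (←)**: if `ŵ(k) = 4π²|k|² v̂(k)` for every
`k ∈ ℤ^d` then `w = -Δ v` weakly (`Torus.IsStokesImage v w`); the converse of
`Torus.IsStokesImage.mFourierCoeff_eq`. Proof: for an admissible test field `g`, Parseval for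
real vector fields (`Torus.hasSum_re_inner_mFourierCoeff_inner`) gives
`⟪w, g⟫ = ∑ₖ Re ⟪ŵ(k), ĝ(k)⟫` and `-⟪v, Δ g⟫ = -∑ₖ Re ⟪v̂(k), (Δ g)^(k)⟫`, and the terms agree
since `(Δ g)^(k) = -4π²|k|² ĝ(k)` (`Torus.mFourierCoeff_complexify_laplacian`)
(Constantin–Foias 1988, Ch. 4, (4.36)–(4.37): `-Δ` and `A` act by the real multiplier
`4π²|k|²`). [cite: ConstantinFoias1988, Ch. 4 (4.36)–(4.37)] -/
theorem isStokesImage_of_mFourierCoeff_eq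
    {v w : Lp (EuclideanSpace ℝ d) 2 (volume : Measure (UnitAddTorus d))}
    (h : ∀ k : d → ℤ, mFourierCoeff (complexify ∘ (w : UnitAddTorus d → EuclideanSpace ℝ d)) k =
      (stokesEigenvalue k : ℂ) •
        mFourierCoeff (complexify ∘ (v : UnitAddTorus d → EuclideanSpace ℝ d)) k) :
    IsStokesImage v w := by
  intro φ ψ g hg _hdiv _hmean hφ hψ
  have H1 := hasSum_re_inner_mFourierCoeff_inner w φ
  have H2 := hasSum_re_inner_mFourierCoeff_inner v ψ
  -- `φ̂ = ĝ`, `ψ̂ = (Δ g)^ = -λ • ĝ`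
  have hφk : ∀ k, mFourierCoeff (complexify ∘ (φ : UnitAddTorus d → EuclideanSpace ℝ d)) k =
      mFourierCoeff (complexify ∘ g) k := fun k =>
    FunctionSpaces.Torus.mFourierCoeff_congr_ae (hφ.fun_comp complexify) k
  have hψk : ∀ k, mFourierCoeff (complexify ∘ (ψ : UnitAddTorus d → EuclideanSpace ℝ d)) k =
      -((stokesEigenvalue k : ℂ) • mFourierCoeff (complexify ∘ g) k) := fun k => by
    rw [FunctionSpaces.Torus.mFourierCoeff_congr_ae (hψ.fun_comp complexify) k]
    exact FunctionSpaces.Torus.mFourierCoeff_complexify_laplacian hg k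
  -- termwise the two Parseval series agree up to sign
  have hterm : ∀ k,
      (inner ℂ (mFourierCoeff (complexify ∘ (w : UnitAddTorus d → EuclideanSpace ℝ d)) k)
        (mFourierCoeff (complexify ∘ (φ : UnitAddTorus d → EuclideanSpace ℝ d)) k)).re =
      -(inner ℂ (mFourierCoeff (complexify ∘ (v : UnitAddTorus d → EuclideanSpace ℝ d)) k)
        (mFourierCoeff (complexify ∘ (ψ : UnitAddTorus d → EuclideanSpace ℝ d)) k)).re := by
    intro k
    rw [h k, hφk k, hψk k, inner_smul_left, Complex.conj_ofReal, inner_neg_right,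
      inner_smul_right, Complex.neg_re, Complex.re_ofReal_mul, neg_neg]
  have H2' := H2.neg
  simp only [← hterm] at H2'
  exact H1.unique H2'

/-! ## Symmetry of `A` (Constantin–Foias 1988, Prop. 4.2) -/

/-- **The Stokes operator in `H` is symmetric**: `⟪A x, y⟫ = ⟪x, A y⟫ on `D(A)`
(`LinearPMap.IsSymmetric`; Constantin–Foias 1988, Ch. 4, Prop. 4.2). The pairs `(x, A x)`,
`(y, A y)` lie in the weak graph (`Submodule.mem_graph_toLinearPMap`) and the inner product of
`H` is that of `L²` (`Submodule.coe_inner`), so this is `Torus.IsStokesImage.inner_symm`.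
[cite: ConstantinFoias1988, Ch. 4 Prop. 4.2] -/
theorem isSymmetric_stokesOperatorH : (stokesOperatorH d).IsSymmetric := by
  intro x y
  have hx := mem_stokesGraphH_iff.mp
    (Submodule.mem_graph_toLinearPMap stokesGraphH_fst_eq_zero_imp x)
  have hy := mem_stokesGraphH_iff.mp
    (Submodule.mem_graph_toLinearPMap stokesGraphH_fst_eq_zero_imp y)
  rw [Submodule.coe_inner, Submodule.coe_inner]
  exact hx.2.2.inner_symm hx.1 hx.2.1 hy.1 hy.2.1 hy.2.2

/-! ## The Stokes eigenfields lie in `D(A)` (Constantin–Foias 1988, (4.42)) -/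

/-- **Transversal single modes are weak eigenpairs**: for `k ≠ 0` and `k · c(k) = 0`, the `L²`
class `G` of the real mode `Re (e_k • c(k))` satisfies `(G, 4π²|k|² G) ∈ stokesGraph d`, i.e.
`G ∈ D(A)` and `A G = 4π²|k|² G` weakly (Constantin–Foias 1988, Ch. 4, (4.42): the
eigenfunctions `c w_k + c̄ w_{-k}`, `c ⊥ k`, with eigenvalue `4π²|k|²/L²`). Proof: `G ∈ H`
(`Torus.toLp_realTrigPoly_singleton_mem_energySpace`), and for an admissible test field `g`,
`⟪4π²|k|² G, g⟫ = 4π²|k|² Re ⟪ĝ(k), c(k)⟫ = -Re ⟪(Δ g)^(k), c(k)⟫ = -⟪G, Δ g⟫`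
(`Torus.inner_toLp_realTrigPoly_singleton`, `Torus.mFourierCoeff_complexify_laplacian`).
[cite: ConstantinFoias1988, Ch. 4 (4.42)] -/
theorem toLp_realTrigPoly_singleton_mem_stokesGraph {k : d → ℤ} (hk : k ≠ 0)
    {c : (d → ℤ) → EuclideanSpace ℂ d} (hc : ∑ j, (k j : ℂ) * c k j = 0) :
    ((memLp_realTrigPoly {k} c 2).toLp (realTrigPoly {k} c),
      stokesEigenvalue k • (memLp_realTrigPoly {k} c 2).toLp (realTrigPoly {k} c)) ∈
        stokesGraph d := by
  have hGH : (memLp_realTrigPoly {k} c 2).toLp (realTrigPoly {k} c) ∈ energySpace d :=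
    toLp_realTrigPoly_singleton_mem_energySpace hk hc
  refine ⟨hGH, Submodule.smul_mem _ _ hGH, ?_⟩
  intro φ ψ g hg _hdiv _hmean hφ hψ
  rw [real_inner_smul_left,
    ← real_inner_comm ((memLp_realTrigPoly {k} c 2).toLp (realTrigPoly {k} c)) φ,
    ← real_inner_comm ((memLp_realTrigPoly {k} c 2).toLp (realTrigPoly {k} c)) ψ,
    inner_toLp_realTrigPoly_singleton φ k c, inner_toLp_realTrigPoly_singleton ψ k c,
    FunctionSpaces.Torus.mFourierCoeff_congr_ae (hφ.fun_comp complexify) k,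
    FunctionSpaces.Torus.mFourierCoeff_congr_ae (hψ.fun_comp complexify) k]
  have hΔ : mFourierCoeff (complexify ∘ fun x => FunctionSpaces.Torus.laplacian g x) k =
      -(((4 * Real.pi ^ 2 * FunctionSpaces.Torus.freqNormSq k : ℝ) : ℂ) •
        mFourierCoeff (complexify ∘ g) k) :=
    FunctionSpaces.Torus.mFourierCoeff_complexify_laplacian hg k
  rw [hΔ, inner_neg_left, inner_smul_left, Complex.conj_ofReal, Complex.neg_re,
    Complex.re_ofReal_mul, neg_neg]
  rfl

/-- The transversal single modes as elements of `D(A)` with their values: for `k ≠ 0`,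
`k · c(k) = 0` there is `x ∈ D(A)` (for the operator `Torus.stokesOperatorH d` in `H`) whose
underlying `L²` class is the mode `G = Re (e_k • c(k))` and with `A x = 4π²|k|² G`
(Constantin–Foias 1988, Ch. 4, (4.42)). [cite: ConstantinFoias1988, Ch. 4 (4.42)] -/
theorem exists_domain_stokesOperatorH_coe_eq {k : d → ℤ} (hk : k ≠ 0)
    {c : (d → ℤ) → EuclideanSpace ℂ d} (hc : ∑ j, (k j : ℂ) * c k j = 0) :
    ∃ x : (stokesOperatorH d).domain,
      ((x : energySpace d) : Lp (EuclideanSpace ℝ d) 2 (volume : Measure (UnitAddTorus d))) =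
          (memLp_realTrigPoly {k} c 2).toLp (realTrigPoly {k} c) ∧
        ((stokesOperatorH d x : energySpace d) :
            Lp (EuclideanSpace ℝ d) 2 (volume : Measure (UnitAddTorus d))) =
          stokesEigenvalue k • (memLp_realTrigPoly {k} c 2).toLp (realTrigPoly {k} c) := by
  have hmem := toLp_realTrigPoly_singleton_mem_stokesGraph hk hc
  set GH : energySpace d := ⟨(memLp_realTrigPoly {k} c 2).toLp (realTrigPoly {k} c), hmem.1⟩
    with hGH
  have hmemH : (GH, stokesEigenvalue k • GH) ∈ stokesGraphH d := mem_stokesGraphH_iff.mpr hmem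
  rw [← graph_stokesOperatorH] at hmemH
  obtain ⟨x, hx1, hx2⟩ := (LinearPMap.mem_graph_iff _).mp hmemH
  exact ⟨x, by rw [hx1], by rw [hx2]; rfl⟩

/-! ## Density of `D(A)`: completeness of the Stokes eigenfields in `H` -/

/-- **`D(A)` is dense in `H`.** The orthogonal complement of `D(A)` in `H` is trivial: an
element `y ∈ H` orthogonal to `D(A)` is orthogonal to every transversal single mode
`Re (e_k • z)` (`exists_domain_stokesOperatorH_coe_eq`), so `Re ⟪ŷ(k), z⟫ = 0` for all
transversal `z`, whence `ŷ(k) = 0` for `k ≠ 0`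
(`mFourierCoeff_eq_zero_of_mem_energySpace_of_forall_re_inner`), `ŷ(0) = 0` as `y ∈ H`, and
`y = 0` by Parseval (`Torus.hasSum_sq_norm_mFourierCoeff_complexify`). This is the completeness
of the Stokes eigenfunctions in `H` (Constantin–Foias 1988, Ch. 4, (4.7) with (4.42)); density
then follows from `Submodule.topologicalClosure_eq_top_iff`.
[cite: ConstantinFoias1988, Ch. 4 (4.7), (4.42)] -/
theorem dense_domain_stokesOperatorH :
    Dense ((stokesOperatorH d).domain : Set (energySpace d)) := by
  rw [Submodule.dense_iff_topologicalClosure_eq_top, Submodule.topologicalClosure_eq_top_iff,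
    Submodule.eq_bot_iff]
  intro y hy
  -- all Fourier coefficients of `y` vanish
  have hcoef : ∀ k : d → ℤ, mFourierCoeff (complexify ∘
      (((y : energySpace d) : Lp (EuclideanSpace ℝ d) 2 (volume : Measure (UnitAddTorus d))) :
        UnitAddTorus d → EuclideanSpace ℝ d)) k = 0 := by
    intro k
    by_cases hk : k = 0
    · subst hk
      exact mFourierCoeff_complexify_coe_zero_of_mem y.2
    refine mFourierCoeff_eq_zero_of_mem_energySpace_of_forall_re_inner y.2 fun z hz => ?_
    obtain ⟨x, hx, -⟩ := exists_domain_stokesOperatorH_coe_eq hk (c := fun _ => z) hz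
    have h0 : ⟪(x : energySpace d), y⟫_ℝ = 0 := Submodule.inner_right_of_mem_orthogonal x.2 hy
    rw [Submodule.coe_inner, hx, real_inner_comm, inner_toLp_realTrigPoly_singleton] at h0
    exact h0
  -- hence `‖y‖² = ∑ₖ ‖ŷ(k)‖² = 0`
  have hP := FunctionSpaces.Torus.hasSum_sq_norm_mFourierCoeff_complexify
    (Lp.memLp ((y : energySpace d) : Lp (EuclideanSpace ℝ d) 2 (volume : Measure (UnitAddTorus d))))
  simp only [hcoef, norm_zero, ne_eq, OfNat.ofNat_ne_zero, not_false_eq_true, zero_pow] at hP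
  have h2 : ‖((y : energySpace d) : Lp (EuclideanSpace ℝ d) 2 (volume : Measure (UnitAddTorus d)))‖
      ^ 2 = 0 := by
    rw [← integral_norm_sq_coe_eq]
    exact hP.unique hasSum_zero
  exact Subtype.ext (norm_eq_zero.mp ((pow_eq_zero_iff two_ne_zero).mp h2))

/-! ## `D(A†) ≤ D(A)` and the theorem (Constantin–Foias 1988, Thm. 4.3) -/

/-- **The adjoint domain is contained in the domain**: `D(A†) ≤ D(A)` for the Stokes operator in
`H`. For `y ∈ D(A†)` with `z = A† y`, testing the adjoint identity `⟪A† y, x⟫ = ⟪y, A x⟫`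
(`LinearPMap.adjoint_isFormalAdjoint`) on the eigenfields `x = Re (e_k • w)`, `A x = 4π²|k|² x`
(`exists_domain_stokesOperatorH_coe_eq`) gives `Re ⟪ẑ(k) - 4π²|k|² ŷ(k), w⟫ = 0` for all
transversal `w`, so `ẑ(k) = 4π²|k|² ŷ(k)` for every `k`
(`mFourierCoeff_eq_zero_of_mem_energySpace_of_forall_re_inner`), and `(y, z)` lies in the weak
graph by `Torus.isStokesImage_of_mFourierCoeff_eq` (Constantin–Foias 1988, Ch. 4, proof of
Thm. 4.3: `u ∈ D(A*)` is shown to lie in `D(A)`). [cite: ConstantinFoias1988, Ch. 4 Thm. 4.3] -/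
theorem adjoint_domain_le_domain_stokesOperatorH :
    (stokesOperatorH d).adjoint.domain ≤ (stokesOperatorH d).domain := by
  intro y hy
  have hd := dense_domain_stokesOperatorH (d := d)
  set z : energySpace d := (stokesOperatorH d).adjoint ⟨y, hy⟩ with hz
  -- the Fourier relation `ẑ(k) = 4π²|k|² ŷ(k)`
  have hrel : ∀ k : d → ℤ, mFourierCoeff (complexify ∘
      ((z : Lp (EuclideanSpace ℝ d) 2 (volume : Measure (UnitAddTorus d))) :
        UnitAddTorus d → EuclideanSpace ℝ d)) k =
      (stokesEigenvalue k : ℂ) • mFourierCoeff (complexify ∘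
        ((y : Lp (EuclideanSpace ℝ d) 2 (volume : Measure (UnitAddTorus d))) :
          UnitAddTorus d → EuclideanSpace ℝ d)) k := by
    intro k
    by_cases hk : k = 0
    · subst hk
      rw [mFourierCoeff_complexify_coe_zero_of_mem z.2,
        mFourierCoeff_complexify_coe_zero_of_mem y.2, smul_zero]
    set lam : ℝ := stokesEigenvalue k with hlam
    -- the difference `u = z - λ y ∈ H` ...
    set u : Lp (EuclideanSpace ℝ d) 2 (volume : Measure (UnitAddTorus d)) :=
      (z : Lp (EuclideanSpace ℝ d) 2 (volume : Measure (UnitAddTorus d))) -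
        lam • (y : Lp (EuclideanSpace ℝ d) 2 (volume : Measure (UnitAddTorus d))) with hu_def
    have hu : u ∈ energySpace d := sub_mem z.2 (Submodule.smul_mem _ _ y.2)
    have hcoe : mFourierCoeff (complexify ∘ (u : UnitAddTorus d → EuclideanSpace ℝ d)) k =
        mFourierCoeff (complexify ∘
          ((z : Lp (EuclideanSpace ℝ d) 2 (volume : Measure (UnitAddTorus d))) :
            UnitAddTorus d → EuclideanSpace ℝ d)) k -
          (lam : ℂ) • mFourierCoeff (complexify ∘
            ((y : Lp (EuclideanSpace ℝ d) 2 (volume : Measure (UnitAddTorus d))) :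
              UnitAddTorus d → EuclideanSpace ℝ d)) k := by
      rw [hu_def, mFourierCoeff_complexify_coe_sub, mFourierCoeff_complexify_coe_smul]
    suffices h0 : mFourierCoeff (complexify ∘ (u : UnitAddTorus d → EuclideanSpace ℝ d)) k = 0 by
      rwa [hcoe, sub_eq_zero] at h0
    -- ... has a `k`-th coefficient pairing to zero with every transversal vector
    refine mFourierCoeff_eq_zero_of_mem_energySpace_of_forall_re_inner hu fun w hw => ?_
    obtain ⟨x, hx1, hx2⟩ := exists_domain_stokesOperatorH_coe_eq hk (c := fun _ => w) hw
    have hadj := LinearPMap.adjoint_isFormalAdjoint hd ⟨y, hy⟩ x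
    rw [Submodule.coe_inner, Submodule.coe_inner, hx1, hx2, real_inner_smul_right,
      inner_toLp_realTrigPoly_singleton, inner_toLp_realTrigPoly_singleton] at hadj
    rw [hcoe, inner_sub_left, inner_smul_left, Complex.conj_ofReal, Complex.sub_re,
      Complex.re_ofReal_mul]
    change (inner ℂ (mFourierCoeff (complexify ∘
        ((z : Lp (EuclideanSpace ℝ d) 2 (volume : Measure (UnitAddTorus d))) :
          UnitAddTorus d → EuclideanSpace ℝ d)) k) ((fun _ : d → ℤ => w) k)).re -
      lam * (inner ℂ (mFourierCoeff (complexify ∘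
        ((y : Lp (EuclideanSpace ℝ d) 2 (volume : Measure (UnitAddTorus d))) :
          UnitAddTorus d → EuclideanSpace ℝ d)) k) ((fun _ : d → ℤ => w) k)).re = 0
    rw [hadj, sub_self]
  have hgraph : (y, z) ∈ (stokesOperatorH d).graph := by
    rw [graph_stokesOperatorH]
    exact isStokesImage_of_mFourierCoeff_eq hrel
  exact (stokesOperatorH d).mem_domain_of_mem_graph hgraph

/-- **The Stokes operator on the flat torus is self-adjoint** (discharge of the named fact
`Torus.isSelfAdjoint_stokesOperatorH`): `A† = A` for `A = Torus.stokesOperatorH d` in the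
Hilbert space `H = Torus.energySpace d` (Constantin–Foias 1988, Ch. 4, **Theorem 4.3**, here in
the space-periodic setting of (4.33)–(4.37), `L = 1`, where `A` is the real multiplier
`4π²|k|²` on its maximal domain `H₂ ∩ H`). Proof: `A ≤ A†` since `A` is symmetric with dense
domain (`isSymmetric_stokesOperatorH`, `dense_domain_stokesOperatorH`,
`LinearPMap.IsFormalAdjoint.le_adjoint`), and `D(A†) ≤ D(A)`
(`adjoint_domain_le_domain_stokesOperatorH`), so `A = A†` by
`LinearPMap.eq_of_le_of_domain_eq`. [cite: ConstantinFoias1988, Ch. 4 Thm. 4.3] -/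
theorem isSelfAdjoint_stokesOperatorH_holds : isSelfAdjoint_stokesOperatorH (d := d) := by
  unfold isSelfAdjoint_stokesOperatorH
  have hd := dense_domain_stokesOperatorH (d := d)
  have hle : stokesOperatorH d ≤ (stokesOperatorH d).adjoint :=
    (isSymmetric_stokesOperatorH (d := d)).le_adjoint hd
  rw [LinearPMap.isSelfAdjoint_def]
  exact (LinearPMap.eq_of_le_of_domain_eq hle
    (le_antisymm hle.1 adjoint_domain_le_domain_stokesOperatorH)).symm

end Torus

end Literature.Analysis.FluidPDE
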